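import Literature.AlgebraicGeometry.Motives.ProductAffineChart
import Literature.AlgebraicGeometry.Motives.RatFnSpec
import HarnessLib

/-!
# Stalks of the product affine chart: relative local coordinates at every point of `E₁ ×_K E₂`

Topic `Literature/AlgebraicGeometry/Motives` (proofs only; no definitions, no named facts).
For `K`-schemes `E₁, E₂` (objects of `Over (Spec K)`) and affine opens `V₁ ⊆ E₁`, `V₂ ⊆ E₂` whose
rings of sections carry the induced `K`-algebra structures, the product chart
`c : Spec (Γ(V₁) ⊗_K Γ(V₂)) → E₁ ×_K E₂` of ★ `Motives.exists_productChart` identifies the local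
ring `𝒪_{E₁ × E₂, q}` at a point `q` of the chart with a localisation of the chart ring
`Γ(V₁) ⊗_K Γ(V₂)`, compatibly with the two projections. Consequently (`Ω` commutes with base
change and localisation, ★ `exists_basis_kaehler_tensor_localization_eq_D`):

* `stalkMap_stalkMap_germ_eq_of_comp_eq` / `isLocalization_atPrime_stalk_Spec` — stalk maps of a
  chart `Spec S → P → Z` factoring through `Spec Γ(Z, W) → Z` are computed on sections, and the
  stalks of `Spec S` are the localisations `S_𝔭` (scheme-side restatements of Mathlib's
  `Scheme.SpecMap_stalkMap_fromSpecStalk` and `StructureSheaf.IsLocalization.to_stalk`; the same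
  plumbing is used in `Summits/ResolutionOfSingularities/…/WildQuotientsSummitReductionStubPair
  QuasiSplitBaseChangeLemmas.lean`, which a `Literature` file cannot import);
* `exists_basis_stalk_tensorObj_eq_D` — **relative local coordinates at every point of the
  product**: if `d y₁, …, d yₙ` is a basis of `Ω[Γ(E₂, V₂)⁄K]`, then at every `q` with
  `pr₁ q ∈ V₁`, `pr₂ q ∈ V₂` the germs `pr₂♯_q (yᵢ)` have differentials forming a basis of
  `Ω[𝒪_{E₁ × E₂, q}⁄Γ(E₁, V₁)]`, `Γ(E₁, V₁)` acting through `pr₁♯_q`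
  (Bosch–Lütkebohmert–Raynaud, *Néron Models*, §2.1 Prop. 3 and §2.2 Prop. 11: relative
  differentials commute with base change; étale/local coordinates);
* `toFunctionField_stalkMap_germ`, `isScalarTower_stalk_functionField_of_algebraMap_eq` — the
  rational function of `pr♯_q (germ s)` is `pr♯ (s)` (★ `RatFn.functionFieldMap_toFunctionField`),
  whence the scalar tower `Γ(X, V) → 𝒪_{Y,q} → K(Y)` «through `pr`»;
* `functionFieldMap_functionFieldMap_algebraMap_of_comp_eq_fromSpec`,
  `functionFieldEquiv_symm_algebraMap_of_comp_eq_fromSpec`,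
  `injective_functionFieldEquiv_symm_comp_algebraMap`, `toFunctionField_inv_stalkMap_germ_eq` —
  the FUNCTION-FIELD compatibilities of a chart factorisation `χ ≫ p = Spec ι ≫ (Spec Γ(Z, W) → Z)`
  (`χ : Spec S → P` an open immersion): with the chart-to-function-field map
  `j_χ := (χ♯)⁻¹ ∘ (S → K(Spec S)) : S → K(P)` (★ `RatFn.functionFieldEquiv`), `j_χ ∘ ι = p♯ ∘ i_W`
  (`i_W : Γ(Z, W) → K(Z)`), `j_χ` is injective, and `j_χ` is the rational function of the stalk-level
  map at every point of the chart — for the product chart: `j ∘ ι₁ = pr₁♯ ∘ i_V`, `j ∘ ι₂ = pr₂♯ ∘ i_V`;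
* `exists_localCoordinates_stalk_tensorObj` — the packaged form (coordinates `wᵢ`, the basis
  `d wᵢ`, and `wᵢ = pr₂♯ (yᵢ)` in `K(E₁ × E₂)`), the shape of
  ★ `exists_localCoordinates_of_isIso_stalkMap`.

Everything is stated over an arbitrary commutative base ring `K` (for the cell: `K := R` a discrete
valuation ring and `E₁ = E₂ := 𝒳` a smooth model, or `K` a field and `Eᵢ` the generic fibres).

Cell `hodgecm-mathlib`, road W of `r₀` ((W0) leaf PCS / PCS-R «stalks and function-field
compatibilities of the product chart» of `B-provers/B-p18/W0-SPEC.md` §4 and `W0-CORE-SPEC.md` §2: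
the `b, hb` input of ★ `isUnitAt_cocycle_of_isIso_stalkMap` at every point of `𝒳 ⊗ 𝒳`, and the
identities `j ∘ ι₁ = pr₁♯ ∘ i_B`, `j ∘ ι₂ = pr₂♯ ∘ i_B` of the core step S7).

## Sources

* S. Bosch, W. Lütkebohmert, M. Raynaud, *Néron Models*, Ergebnisse (3) 21, Springer 1990,
  §2.1 Prop. 3, §2.2 Prop. 11. [BLRNeronModels1990]
* R. Hartshorne, *Algebraic Geometry*, GTM 52, II Prop. 2.2 (b) (`𝒪_{Spec A, 𝔭} = A_𝔭`),
  II Thm. 3.3. [Hartshorne1977]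
* U. Görtz, T. Wedhorn, *Algebraic Geometry I: Schemes*, 2nd ed., Springer Spektrum 2020,
  Def. 3.28 – Prop. 3.29 (function field, `Γ(U, 𝒪) ⊆ 𝒪_{X,x} ⊆ K(X)`). [GortzWedhorn2020]
-/

noncomputable section

universe u

namespace Literature.AlgebraicGeometry.Motives

open CategoryTheory Limits _root_.AlgebraicGeometry MonoidalCategory CartesianMonoidalCategory
open TensorProduct

/-! ### Stalk maps of a chart through `Spec` of sections -/

section StalkOfChart

variable {Z P : Scheme.{u}} {S : CommRingCat.{u}} (χ : Spec S ⟶ P) (p : P ⟶ Z) {W : Z.Opens}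
  (hW : IsAffineOpen W) (ι : Γ(Z, W) ⟶ S)

/-- **Stalk maps of a chart are computed on sections.** If `χ : Spec S → P` and `p : P → Z`
satisfy `χ ≫ p = Spec ι ≫ (Spec Γ(Z, W) → Z)` for an affine open `W ⊆ Z` and a ring map
`ι : Γ(Z, W) → S`, then for every `t ∈ Spec S` the composite
`Γ(Z, W) → 𝒪_{Z, p(χ t)} → 𝒪_{P, χ t} → 𝒪_{Spec S, t}` of the germ map with the two stalk maps is
`Γ(Z, W) → S = Γ(Spec S) → 𝒪_{Spec S, t}` (Mathlib `Scheme.SpecMap_stalkMap_fromSpecStalk`,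
`Spec Γ(Z, W) → Z` being a monomorphism). [cite: Hartshorne1977, II Prop. 2.2 (b)–(c)] -/
theorem germ_stalkMap_stalkMap_eq_of_comp_eq_fromSpec (hχ : χ ≫ p = Spec.map ι ≫ hW.fromSpec)
    (t : Spec S) (ht : p (χ t) ∈ W) :
    Z.presheaf.germ W (p (χ t)) ht ≫ p.stalkMap (χ t) ≫ χ.stalkMap t =
      ι ≫ (Scheme.ΓSpecIso S).inv ≫ (Spec S).presheaf.germ ⊤ t trivial := by
  apply Spec.map_injective
  rw [← cancel_mono hW.fromSpec]
  simp only [Spec.map_comp, Category.assoc]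
  have e1 : Spec.map (Z.presheaf.germ W (p (χ t)) ht) ≫ hW.fromSpec = Z.fromSpecStalk (p (χ t)) := by
    rw [← hW.fromSpecStalk_eq_fromSpecStalk ht]
    rfl
  rw [e1, Scheme.SpecMap_stalkMap_fromSpecStalk, Scheme.SpecMap_stalkMap_fromSpecStalk_assoc, hχ,
    Spec.fromSpecStalk_eq, Spec.map_comp, Category.assoc]

/-- Elementwise form of `germ_stalkMap_stalkMap_eq_of_comp_eq_fromSpec`: the germ of a section
`s ∈ Γ(Z, W)` pulled back along `p` and then along the chart `χ` is the germ of `ι s` on `Spec S`.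
[cite: Hartshorne1977, II Prop. 2.2 (b)–(c)] -/
theorem stalkMap_stalkMap_germ_eq_of_comp_eq_fromSpec (hχ : χ ≫ p = Spec.map ι ≫ hW.fromSpec)
    (t : Spec S) (ht : p (χ t) ∈ W) (s : Γ(Z, W)) :
    (χ.stalkMap t).hom ((p.stalkMap (χ t)).hom ((Z.presheaf.germ W (p (χ t)) ht).hom s)) =
      ((Spec S).presheaf.germ ⊤ t trivial).hom ((Scheme.ΓSpecIso S).inv.hom (ι.hom s)) := by
  have h := germ_stalkMap_stalkMap_eq_of_comp_eq_fromSpec χ p hW ι hχ t ht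
  have h' := congrArg (fun φ => φ.hom s) h
  simp only [CommRingCat.hom_comp, RingHom.coe_comp, Function.comp_apply] at h'
  exact h'

/-- **`𝒪_{Spec S, t} = S_t`** for the algebra structure `S = Γ(Spec S) → 𝒪_{Spec S, t}` written
through `Scheme.ΓSpecIso` (Mathlib `StructureSheaf.IsLocalization.to_stalk` on the scheme side).
[cite: Hartshorne1977, II Prop. 2.2 (b)] -/
theorem isLocalization_atPrime_stalk_Spec (t : Spec S) :
    letI := (((Scheme.ΓSpecIso S).inv ≫ (Spec S).presheaf.germ ⊤ t trivial).hom).toAlgebra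
    IsLocalization.AtPrime ((Spec S).presheaf.stalk t) t.asIdeal := by
  have h : (Scheme.ΓSpecIso S).inv ≫ (Spec S).presheaf.germ ⊤ t trivial = StructureSheaf.toStalk S t :=
    Spec.map_injective ((Spec.fromSpecStalk_eq S t).symm.trans (Spec.fromSpecStalk_eq' S t))
  rw [h]
  exact StructureSheaf.IsLocalization.to_stalk S t

/-- **The stalk of `P` at a point of a chart `χ : Spec S → P` (an open immersion) is the
localisation `S_t`**, for the algebra structure `S → 𝒪_{Spec S, t} ≅ 𝒪_{P, χ t}` obtained by
inverting the stalk map of `χ`. [cite: Hartshorne1977, II Prop. 2.2 (b)] -/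
theorem isLocalization_atPrime_stalk_of_isOpenImmersion [IsOpenImmersion χ] (t : Spec S) :
    letI := ((inv (χ.stalkMap t)).hom.comp
      (((Scheme.ΓSpecIso S).inv ≫ (Spec S).presheaf.germ ⊤ t trivial).hom)).toAlgebra
    IsLocalization.AtPrime (P.presheaf.stalk (χ t)) t.asIdeal := by
  letI i₁ := (((Scheme.ΓSpecIso S).inv ≫ (Spec S).presheaf.germ ⊤ t trivial).hom).toAlgebra
  letI i₂ := ((inv (χ.stalkMap t)).hom.comp
      (((Scheme.ΓSpecIso S).inv ≫ (Spec S).presheaf.germ ⊤ t trivial).hom)).toAlgebra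
  haveI : IsLocalization.AtPrime ((Spec S).presheaf.stalk t) t.asIdeal :=
    isLocalization_atPrime_stalk_Spec t
  let e : ((Spec S).presheaf.stalk t) ≃+* (P.presheaf.stalk (χ t)) :=
    (asIso (χ.stalkMap t)).symm.commRingCatIsoToRingEquiv
  have he : ∀ s : S, e (algebraMap S ((Spec S).presheaf.stalk t) s) =
      algebraMap S (P.presheaf.stalk (χ t)) s := fun s => rfl
  exact IsLocalization.isLocalization_of_algEquiv t.asIdeal.primeCompl
    (AlgEquiv.ofRingEquiv (f := e) he)

end StalkOfChart

/-! ### Relative local coordinates at the points of `E₁ ×_K E₂` -/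

section Chart

variable {K : Type u} [CommRing K] (E₁ E₂ : Over (Spec (.of K)))
  {V₁ : E₁.left.Opens} (hV₁ : IsAffineOpen V₁) {V₂ : E₂.left.Opens} (hV₂ : IsAffineOpen V₂)
  [Algebra K Γ(E₁.left, V₁)] [Algebra K Γ(E₂.left, V₂)]

set_option maxHeartbeats 400000 in
include hV₁ hV₂ in
/-- **Stalks of the product chart / relative coordinates at a point of `E₁ ×_K E₂`.**
For affine opens `V₁ ⊆ E₁`, `V₂ ⊆ E₂` (sections with the induced `K`-algebra structures) and an
exact basis `d y₁, …, d yₙ` of `Ω[Γ(E₂, V₂)⁄K]`, at every point `q` of `E₁ ×_K E₂` with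
`pr₁ q ∈ V₁`, `pr₂ q ∈ V₂` the germs `wᵢ := pr₂♯_q (yᵢ) ∈ 𝒪_{E₁ × E₂, q}` are local coordinates at `q`
RELATIVE to `A₁ := Γ(E₁, V₁)` (acting through `pr₁♯_q`, hypothesis `hA`): `d w₁, …, d wₙ` is a
basis of `Ω[𝒪_{E₁ × E₂, q}⁄A₁]` — the stalk is a localisation of the chart ring `A₁ ⊗_K Γ(E₂, V₂)`
(★ `exists_productChart`) and `Ω` commutes with base change and localisation
(★ `exists_basis_kaehler_tensor_localization_eq_D`).
[cite: BLRNeronModels1990, §2.1 Prop. 3, §2.2 Prop. 11] -/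
theorem exists_basis_stalk_tensorObj_eq_D
    (h₁ : algebraMap K Γ(E₁.left, V₁) = ((Scheme.ΓSpecIso (.of K)).inv ≫ E₁.hom.appLE ⊤ V₁ le_top).hom)
    (h₂ : algebraMap K Γ(E₂.left, V₂) = ((Scheme.ΓSpecIso (.of K)).inv ≫ E₂.hom.appLE ⊤ V₂ le_top).hom)
    {n : ℕ} {y : Fin n → Γ(E₂.left, V₂)}
    (bV : Module.Basis (Fin n) Γ(E₂.left, V₂) Ω[Γ(E₂.left, V₂)⁄K])
    (hbV : ∀ i, bV i = KaehlerDifferential.D K _ (y i))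
    (q : ↥(E₁ ⊗ E₂).left) (hq₁ : (fst E₁ E₂).left.base q ∈ V₁) (hq₂ : (snd E₁ E₂).left.base q ∈ V₂)
    [Algebra Γ(E₁.left, V₁) ((E₁ ⊗ E₂).left.presheaf.stalk q)]
    (hA : algebraMap Γ(E₁.left, V₁) ((E₁ ⊗ E₂).left.presheaf.stalk q) =
      ((fst E₁ E₂).left.stalkMap q).hom.comp
        (E₁.left.presheaf.germ V₁ ((fst E₁ E₂).left.base q) hq₁).hom) :
    ∃ b : Module.Basis (Fin n) ((E₁ ⊗ E₂).left.presheaf.stalk q)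
        Ω[((E₁ ⊗ E₂).left.presheaf.stalk q)⁄Γ(E₁.left, V₁)],
      ∀ i, b i = KaehlerDifferential.D Γ(E₁.left, V₁) _
        ((snd E₁ E₂).left.stalkMap q (E₂.left.presheaf.germ V₂ ((snd E₁ E₂).left.base q) hq₂ (y i))) := by
  -- the product chart through `q`
  obtain ⟨c, hc, hrange, hc₁, hc₂⟩ := exists_productChart E₁ E₂ hV₁ hV₂ h₁ h₂
  have hq : q ∈ Set.range c := by
    rw [hrange]
    exact ⟨hq₁, hq₂⟩
  obtain ⟨t, rfl⟩ := hq
  -- the chart ring acts on the stalk through the (invertible) stalk map of `c`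
  let ψ : (Γ(E₁.left, V₁) ⊗[K] Γ(E₂.left, V₂)) →+* (E₁ ⊗ E₂).left.presheaf.stalk (c t) :=
    (inv (c.stalkMap t)).hom.comp
      (((Scheme.ΓSpecIso (.of (Γ(E₁.left, V₁) ⊗[K] Γ(E₂.left, V₂)))).inv ≫
        (Spec (.of (Γ(E₁.left, V₁) ⊗[K] Γ(E₂.left, V₂)))).presheaf.germ ⊤ t trivial).hom)
  letI : Algebra (Γ(E₁.left, V₁) ⊗[K] Γ(E₂.left, V₂)) ((E₁ ⊗ E₂).left.presheaf.stalk (c t)) :=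
    ψ.toAlgebra
  haveI : IsLocalization.AtPrime ((E₁ ⊗ E₂).left.presheaf.stalk (c t)) t.asIdeal :=
    isLocalization_atPrime_stalk_of_isOpenImmersion c t
  -- the two factorisations of the chart, read on stalks
  have key : ∀ (Z : Scheme.{u}) (pr : (E₁ ⊗ E₂).left ⟶ Z) (W : Z.Opens) (hW : IsAffineOpen W)
      (ι : Γ(Z, W) →+* Γ(E₁.left, V₁) ⊗[K] Γ(E₂.left, V₂))
      (hfac : c ≫ pr = Spec.map (CommRingCat.ofHom ι) ≫ hW.fromSpec) (ht : pr (c t) ∈ W)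
      (s : Γ(Z, W)),
      (pr.stalkMap (c t)).hom ((Z.presheaf.germ W (pr (c t)) ht).hom s) = ψ (ι s) := by
    intro Z pr W hW ι hfac ht s
    have h := stalkMap_stalkMap_germ_eq_of_comp_eq_fromSpec c pr hW (CommRingCat.ofHom ι) hfac t ht s
    have hinv : ∀ z, (inv (c.stalkMap t)).hom ((c.stalkMap t).hom z) = z := fun z => by
      rw [← CommRingCat.comp_apply, IsIso.hom_inv_id, CommRingCat.id_apply]
    have h' := congrArg (inv (c.stalkMap t)).hom h
    rw [hinv] at h'
    exact h'
  -- scalar tower `A₁ → A₁ ⊗ A₂ → 𝒪_{E₁ × E₂, q}`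
  haveI : IsScalarTower Γ(E₁.left, V₁) (Γ(E₁.left, V₁) ⊗[K] Γ(E₂.left, V₂))
      ((E₁ ⊗ E₂).left.presheaf.stalk (c t)) := by
    refine IsScalarTower.of_algebraMap_eq fun a => ?_
    have hR : algebraMap (Γ(E₁.left, V₁) ⊗[K] Γ(E₂.left, V₂))
        ((E₁ ⊗ E₂).left.presheaf.stalk (c t)) = ψ := rfl
    rw [hR, Algebra.TensorProduct.algebraMap_apply, Algebra.algebraMap_self, RingHom.id_apply, hA,
      RingHom.comp_apply]
    exact key E₁.left (fst E₁ E₂).left V₁ hV₁ Algebra.TensorProduct.includeLeftRingHom hc₁ hq₁ a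
  -- `Ω` commutes with base change and localisation
  obtain ⟨b, hb⟩ := exists_basis_kaehler_tensor_localization_eq_D K Γ(E₁.left, V₁) Γ(E₂.left, V₂)
    bV hbV ((E₁ ⊗ E₂).left.presheaf.stalk (c t)) t.asIdeal.primeCompl
  refine ⟨b, fun i => ?_⟩
  rw [hb i]
  congr 1
  have hR : algebraMap (Γ(E₁.left, V₁) ⊗[K] Γ(E₂.left, V₂))
      ((E₁ ⊗ E₂).left.presheaf.stalk (c t)) = ψ := rfl
  rw [hR]
  exact (key E₂.left (snd E₁ E₂).left V₂ hV₂
    (Algebra.TensorProduct.includeRight (R := K) (A := Γ(E₁.left, V₁))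
      (B := Γ(E₂.left, V₂))).toRingHom hc₂ hq₂ (y i)).symm

end Chart

/-! ### Rational functions of the chart coordinates -/

section FunctionField

open RatFn

variable {X Y : Scheme.{u}} [IsIntegral X] [IsIntegral Y] (pr : Y ⟶ X) [IsDominant pr]
  {V : X.Opens} [Nonempty V]

/-- **The rational function of a pulled-back germ is the pull-back of the rational function**:
for a dominant morphism `pr : Y → X` of integral schemes, `q ∈ Y` with `pr q ∈ V` and a section
`s ∈ Γ(X, V)`, the image in `K(Y)` of `pr♯_q (germ s) ∈ 𝒪_{Y,q}` is `pr♯ (s)` with `s` read in `K(X)`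
(★ `RatFn.functionFieldMap_toFunctionField`, ★ `RatFn.toFunctionField_germ`; Görtz–Wedhorn I,
Prop. 3.29 (2): the rational function of a germ does not depend on the point, and (11.16):
`K(X) → K(Y)` extends the stalk maps). [cite: GortzWedhorn2020, Prop. 3.29 (2)] -/
theorem toFunctionField_stalkMap_germ (q : Y) (hq : pr q ∈ V) (s : Γ(X, V)) :
    toFunctionField q (pr.stalkMap q (X.presheaf.germ V (pr q) hq s)) =
      functionFieldMap pr (algebraMap Γ(X, V) X.functionField s) := by
  rw [← functionFieldMap_toFunctionField pr q]
  congr 1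
  exact toFunctionField_algebraMap_stalk (V := V) ⟨pr q, hq⟩ s

/-- **Scalar tower `Γ(X, V) → 𝒪_{Y,q} → K(Y)`** for the algebra structures «through `pr`»:
`Γ(X, V) → 𝒪_{X, pr q} → 𝒪_{Y, q}` (germ, then `pr♯_q`) and `Γ(X, V) → K(X) → K(Y)` (then `pr♯`).
This is the `IsScalarTower A (𝒪_{Y,q}) K(Y)` side condition of ★ `isUnitAt_cocycle_of_isIso_stalkMap`
/ ★ `exists_basis_functionField_of_localCoordinates'` for `A = Γ(X, V)` (Görtz–Wedhorn I,
Prop. 3.29 (1)–(2): `Γ(X, V) ⊆ 𝒪_{X,x} ⊆ K(X)` compatibly). [cite: GortzWedhorn2020, Prop. 3.29 (1)–(2)] -/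
theorem isScalarTower_stalk_functionField_of_algebraMap_eq (q : Y) (hq : pr q ∈ V)
    [Algebra Γ(X, V) (Y.presheaf.stalk q)] [Algebra Γ(X, V) Y.functionField]
    (hA : algebraMap Γ(X, V) (Y.presheaf.stalk q) =
      (pr.stalkMap q).hom.comp (X.presheaf.germ V (pr q) hq).hom)
    (hAK : algebraMap Γ(X, V) Y.functionField =
      (functionFieldMap pr).comp (algebraMap Γ(X, V) X.functionField)) :
    IsScalarTower Γ(X, V) (Y.presheaf.stalk q) Y.functionField := by
  refine IsScalarTower.of_algebraMap_eq fun s => ?_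
  rw [hAK, hA, RingHom.comp_apply, RingHom.comp_apply]
  exact (toFunctionField_stalkMap_germ pr q hq s).symm

end FunctionField

/-! ### Function-field compatibilities of a chart factorisation -/

section FunctionFieldChart

open RatFn

variable {Z P : Scheme.{u}} [IsIntegral Z] [IsIntegral P] {S : CommRingCat.{u}}
  (χ : Spec S ⟶ P) [IsDominant χ] (p : P ⟶ Z) [IsDominant p]
  {W : Z.Opens} (hW : IsAffineOpen W) [Nonempty W] (ι : Γ(Z, W) ⟶ S)

variable [IsDomain S]

/-- **Function-field compatibility of a chart factorisation.** If `χ : Spec S → P` and `p : P → Z`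
(dominant morphisms of integral schemes) satisfy `χ ≫ p = Spec ι ≫ (Spec Γ(Z, W) → Z)` for an
affine open `W ⊆ Z` and a ring map `ι : Γ(Z, W) → S`, then for `s ∈ Γ(Z, W)` the rational function
`p♯ (s) ∈ K(P)` restricts along `χ` to `ι s ∈ S ⊆ K(Spec S)`:
`χ♯ (p♯ (s)) = algebraMap S K(Spec S) (ι s)` (the stalk computation
`germ_stalkMap_stalkMap_eq_of_comp_eq_fromSpec` at the generic point; Görtz–Wedhorn I,
Prop. 3.29 (2) and (2.10.2)). [cite: GortzWedhorn2020, Prop. 3.29 (2)] -/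
theorem functionFieldMap_functionFieldMap_algebraMap_of_comp_eq_fromSpec
    (hχ : χ ≫ p = Spec.map ι ≫ hW.fromSpec) (s : Γ(Z, W)) :
    functionFieldMap χ (functionFieldMap p (algebraMap Γ(Z, W) Z.functionField s)) =
      algebraMap S (Spec S).functionField (ι s) := by
  let ξ := genericPoint (Spec S)
  have ht : p (χ ξ) ∈ W := by
    rw [← Scheme.Hom.comp_apply, hχ, Scheme.Hom.comp_apply]
    have : hW.fromSpec (Spec.map ι ξ) ∈ Set.range hW.fromSpec := ⟨_, rfl⟩
    rwa [hW.range_fromSpec] at this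
  have ht' : (χ ≫ p) ξ ∈ W := by rwa [Scheme.Hom.comp_apply]
  rw [← RingHom.comp_apply, ← functionFieldMap_comp p χ]
  have e1 : algebraMap Γ(Z, W) Z.functionField s =
      toFunctionField ((χ ≫ p) ξ) (Z.presheaf.germ W ((χ ≫ p) ξ) ht' s) :=
    (toFunctionField_germ ht' s).symm
  rw [e1, functionFieldMap_toFunctionField (χ ≫ p) ξ]
  -- the stalk computation at the generic point of the chart
  have key : Z.presheaf.germ W ((χ ≫ p) ξ) ht' ≫ (χ ≫ p).stalkMap ξ =
      ι ≫ (Scheme.ΓSpecIso S).inv ≫ (Spec S).presheaf.germ ⊤ ξ trivial := by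
    rw [Scheme.Hom.stalkMap_comp]
    exact germ_stalkMap_stalkMap_eq_of_comp_eq_fromSpec χ p hW ι hχ ξ ht
  have key' := congrArg (fun φ => toFunctionField ξ (φ.hom s)) key
  simp only [CommRingCat.hom_comp, RingHom.coe_comp, Function.comp_apply] at key'
  refine key'.trans ?_
  rw [algebraMap_functionField_Spec]
  exact toFunctionField_germ (U := ⊤) (x := ξ) trivial _

variable [IsOpenImmersion χ]

/-- **The chart ring inside the function field.** For an open immersion `χ : Spec S → P` into an
integral scheme, the composite `j_χ : S → K(Spec S) ≅ K(P)` (`K(P) ≅ K(Spec S)` by `χ♯`,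
★ `RatFn.functionFieldEquiv`) satisfies `j_χ (ι s) = p♯ (s)` for every factorisation
`χ ≫ p = Spec ι ≫ (Spec Γ(Z, W) → Z)` — «the chart-to-function-field map is compatible with the
projections» (Görtz–Wedhorn I, Prop. 3.29 (1)–(2)). [cite: GortzWedhorn2020, Prop. 3.29 (1)–(2)] -/
theorem functionFieldEquiv_symm_algebraMap_of_comp_eq_fromSpec
    (hχ : χ ≫ p = Spec.map ι ≫ hW.fromSpec) (s : Γ(Z, W)) :
    (functionFieldEquiv χ).symm (algebraMap S (Spec S).functionField (ι s)) =
      functionFieldMap p (algebraMap Γ(Z, W) Z.functionField s) := by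
  apply (functionFieldEquiv χ).injective
  rw [RingEquiv.apply_symm_apply, functionFieldEquiv_apply,
    functionFieldMap_functionFieldMap_algebraMap_of_comp_eq_fromSpec χ p hW ι hχ s]

omit [IsIntegral Z] [IsDominant p] [Nonempty W] in
/-- The chart-to-function-field map `j_χ : S → K(Spec S) ≅ K(P)` of an open immersion
`χ : Spec S → P` (`S` a domain) is injective (`K(Spec S) = Frac S`, Görtz–Wedhorn I,
Prop. 3.29 (1)). [cite: GortzWedhorn2020, Prop. 3.29 (1)] -/
theorem injective_functionFieldEquiv_symm_comp_algebraMap :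
    Function.Injective ((functionFieldEquiv χ).symm.toRingHom.comp
      (algebraMap S (Spec S).functionField)) :=
  (functionFieldEquiv χ).symm.injective.comp (IsFractionRing.injective S (Spec S).functionField)

/-- The chart-to-function-field map read on stalks: for `t ∈ Spec S` and `z ∈ S`, the rational
function of `ψ_t z ∈ 𝒪_{P, χ t}` (`ψ_t : S → 𝒪_{Spec S, t} ≅ 𝒪_{P, χ t}`, the algebra structure of
`isLocalization_atPrime_stalk_of_isOpenImmersion`) is `j_χ z` (Görtz–Wedhorn I, Prop. 3.29 (2):
independence of the point). [cite: GortzWedhorn2020, Prop. 3.29 (2)] -/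
theorem toFunctionField_inv_stalkMap_germ_eq (t : Spec S) (z : S) :
    toFunctionField (χ t) ((inv (χ.stalkMap t)).hom
      (((Spec S).presheaf.germ ⊤ t trivial).hom ((Scheme.ΓSpecIso S).inv.hom z))) =
      (functionFieldEquiv χ).symm (algebraMap S (Spec S).functionField z) := by
  apply (functionFieldEquiv χ).injective
  rw [RingEquiv.apply_symm_apply, functionFieldEquiv_apply, functionFieldMap_toFunctionField χ t,
    ← CommRingCat.comp_apply, IsIso.inv_hom_id, CommRingCat.id_apply, algebraMap_functionField_Spec]
  exact toFunctionField_germ (U := ⊤) (x := t) trivial _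

end FunctionFieldChart

/-! ### Packaged form for the (W0) core: coordinates, their differentials and rational functions -/

section Packaged

open RatFn

variable {K : Type u} [CommRing K] (E₁ E₂ : Over (Spec (.of K)))
  {V₁ : E₁.left.Opens} (hV₁ : IsAffineOpen V₁) {V₂ : E₂.left.Opens} (hV₂ : IsAffineOpen V₂)
  [Algebra K Γ(E₁.left, V₁)] [Algebra K Γ(E₂.left, V₂)]
  [IsIntegral E₂.left] [IsIntegral (E₁ ⊗ E₂).left] [IsDominant (snd E₁ E₂).left] [Nonempty V₂]

include hV₁ hV₂ in
/-- **Relative local coordinates at every point of `E₁ ×_K E₂`, packaged**: under the hypotheses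
of `exists_basis_stalk_tensorObj_eq_D` (and `E₂`, `E₁ × E₂` integral, `pr₂` dominant), at every
`q` with `pr₁ q ∈ V₁`, `pr₂ q ∈ V₂` there are `w₁, …, wₙ ∈ 𝒪_{E₁ × E₂, q}` with `d wᵢ` a basis of
`Ω[𝒪_{E₁ × E₂, q}⁄Γ(E₁, V₁)]` and whose rational functions are the pull-backs `pr₂♯ (yᵢ)` of the
chart coordinates (the shape of ★ `exists_localCoordinates_of_isIso_stalkMap`).
[cite: BLRNeronModels1990, §2.2 Prop. 11] -/
theorem exists_localCoordinates_stalk_tensorObj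
    (h₁ : algebraMap K Γ(E₁.left, V₁) = ((Scheme.ΓSpecIso (.of K)).inv ≫ E₁.hom.appLE ⊤ V₁ le_top).hom)
    (h₂ : algebraMap K Γ(E₂.left, V₂) = ((Scheme.ΓSpecIso (.of K)).inv ≫ E₂.hom.appLE ⊤ V₂ le_top).hom)
    {n : ℕ} {y : Fin n → Γ(E₂.left, V₂)}
    (bV : Module.Basis (Fin n) Γ(E₂.left, V₂) Ω[Γ(E₂.left, V₂)⁄K])
    (hbV : ∀ i, bV i = KaehlerDifferential.D K _ (y i))
    (q : ↥(E₁ ⊗ E₂).left) (hq₁ : (fst E₁ E₂).left.base q ∈ V₁) (hq₂ : (snd E₁ E₂).left.base q ∈ V₂)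
    [Algebra Γ(E₁.left, V₁) ((E₁ ⊗ E₂).left.presheaf.stalk q)]
    (hA : algebraMap Γ(E₁.left, V₁) ((E₁ ⊗ E₂).left.presheaf.stalk q) =
      ((fst E₁ E₂).left.stalkMap q).hom.comp
        (E₁.left.presheaf.germ V₁ ((fst E₁ E₂).left.base q) hq₁).hom) :
    ∃ (w : Fin n → (E₁ ⊗ E₂).left.presheaf.stalk q)
      (b : Module.Basis (Fin n) ((E₁ ⊗ E₂).left.presheaf.stalk q)
        Ω[((E₁ ⊗ E₂).left.presheaf.stalk q)⁄Γ(E₁.left, V₁)]),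
      (∀ i, b i = KaehlerDifferential.D Γ(E₁.left, V₁) _ (w i)) ∧
      ∀ i, toFunctionField q (w i) =
        functionFieldMap (snd E₁ E₂).left (algebraMap Γ(E₂.left, V₂) E₂.left.functionField (y i)) := by
  obtain ⟨b, hb⟩ := exists_basis_stalk_tensorObj_eq_D E₁ E₂ hV₁ hV₂ h₁ h₂ bV hbV q hq₁ hq₂ hA
  exact ⟨_, b, hb, fun i => toFunctionField_stalkMap_germ (snd E₁ E₂).left q hq₂ (y i)⟩

end Packaged

end Literature.AlgebraicGeometry.Motives

end
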